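import Mathlib
import Literature.Probability.RandomPlanarGeometry.HexParafermion
import Literature.Probability.RandomPlanarGeometry.HexSAW

/-!
# crux-plan `birkhoff-crosscut-contraction` (stmt-CriticalPhenomena-14004 `BoundaryClosureR`) — typed salvage

Outcome of this crux-plan seat: **no-skeleton** (see `Lines/birkhoff-crosscut-contraction.md`).
This file is NOT a skeleton (no `stub_*`, no `sorry`, no `BoundaryClosureR_of`); it only types, over
existing declarations, the statements that the analysis produced, so that later seats can cite them:

* `SingleCrossingNegligible` — the NEGATIVE prediction that kills the card's step (B): the x_c-mass of
  walks crossing a half-circle of lattice radius `s` EXACTLY ONCE is `o(1)` of the total as `s → ∞`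
  (predicted `≍ s^{-25/24}`), so the card's exact "single-crossing skeleton" factorisation carries a
  vanishing fraction of the arrival mass and cannot be the main term of a contraction argument.
* `ThickBacktrackSuppression` — the correct positive-mass input (B′): walks from a far root to a
  deep target rarely cross a half-annulus of aspect `M` three times (rate in `M`).
* `CarvedBlockComparability` — the correct one-scale input (D′), stated at WALK level: cross-ratios
  of no-backtrack arrival masses under arbitrary OUTER carvings (any far domain agreeing with the flat
  half-lattice inside radius `s`) and arbitrary INNER carvings (any obstacle set and target inside
  radius `s' = s/M`) are bounded by a constant `e^{Δ₀}` — constants only, transfer-matrix decidable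
  scale by scale; it is equivalent to a bounded Hilbert projective diameter of the free-block transfer
  kernel between thick-crosscut states.
* `BirkhoffHopfContraction` — the abstract theorem (not in Mathlib).
* `FlatBoundaryRatioMixingQ` — the qualitative flat-ball two-root boundary Harnack principle the
  consumers actually use (ε–M form), and `ContractionEngine` — the shape of the repaired engine
  `BirkhoffHopf → CarvedBlockComparability → ThickBacktrackSuppression → FlatBoundaryRatioMixingQ`
  (internal lemma: on the no-backtrack class the thick-crosscut strand systems are SEPARATING states —
  one through-strand per thick crosscut — so the mass is an EXACT product of entrywise-positive
  free-block kernels; Birkhoff contracts it geometrically in the number of blocks; the backtrack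
  class is removed once, globally).

Everything is a `def … : Prop`; the file must only elaborate.
-/

noncomputable section

open scoped BigOperators Classical
open Literature.Probability.LatticeModels Literature.Probability.RandomPlanarGeometry
open Literature.Probability.RandomPlanarGeometry.SAW

namespace Summit.CriticalPhenomena.SAWScalingLimit.Cruxes.BoundaryClosureR.CruxplanBirkhoff

/-! ### Vocabulary (lattice units, spin 0) -/

/-- Radial distance of the hexagon centre of `v` from the point `p`. -/
def rad (p : ℂ) (v : HexVertex) : ℝ := dist (hexCenter v) p

/-- Spin-`0` arrival mass `Z^Λ_q(e) = Σ_{γ : q → e} x_c^{ℓ(γ)} = ‖F_{x_c,0}(e)‖`. -/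
def Z (Λ : Finset HexVertex) (q e : Sym2 HexVertex) : ℝ :=
  ‖hexParafermionicObservable Λ q hexCriticalFugacity 0 e‖

/-- Number of lattice steps of the vertex list `l` that straddle the circle `|z - p| = s`. -/
def numCrossings (p : ℂ) (s : ℝ) (l : List HexVertex) : ℕ :=
  ((l.zip l.tail).filter fun uw =>
      decide ((rad p uw.1 < s ∧ s ≤ rad p uw.2) ∨ (rad p uw.2 < s ∧ s ≤ rad p uw.1))).length

/-- The vertex list `l` BACKTRACKS across the closed half-annulus `s' ≤ |z - p| ≤ s`: it contains
three vertices, in order, at radii `≤ s', ≥ s, ≤ s'` or `≥ s, ≤ s', ≥ s` (a triple crossing). -/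
def HasBacktrack (p : ℂ) (s' s : ℝ) (l : List HexVertex) : Prop :=
  ∃ (u v w : HexVertex) (l₁ l₂ l₃ l₄ : List HexVertex),
    l = l₁ ++ u :: l₂ ++ v :: l₃ ++ w :: l₄ ∧
      ((rad p u ≤ s' ∧ s ≤ rad p v ∧ rad p w ≤ s') ∨ (s ≤ rad p u ∧ rad p v ≤ s' ∧ s ≤ rad p w))

/-- The no-backtrack part of the arrival mass: walks `q → e` in `Λ` that do not backtrack across
the half-annulus `[s', s]` around `p`. -/
def nbMass (Λ : Finset HexVertex) (q e : Sym2 HexVertex) (p : ℂ) (s' s : ℝ) : ℝ :=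
  ∑ γ : HexMidEdgeSAW Λ q e, if HasBacktrack p s' s γ.verts then 0 else hexCriticalFugacity ^ γ.length

/-- OUTER CONDITION at radius `s`: a simply connected domain that is EXACTLY the flat half-lattice
`{row ≥ n}` inside the open ball `B(p, s)` (arbitrary outside), with a boundary root `q` whose two
hexagons lie at radius `≥ s`. -/
def IsOuterCondition (p : ℂ) (n : ℤ) (s : ℝ) (Λ : Finset HexVertex) (q : Sym2 HexVertex) : Prop :=
  hexDomainSimplyConnected Λ ∧ q ∈ hexDomainBoundary Λ ∧ (∀ v ∈ q, s ≤ rad p v) ∧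
    ∀ v : HexVertex, rad p v < s → (v ∈ Λ ↔ n ≤ v.1 1)

/-- INNER CONDITION at radius `s'`: an obstacle set `J` (vertices to delete) and a target mid-edge
`e`, both inside the open ball `B(p, s')`. -/
def IsInnerCondition (p : ℂ) (s' : ℝ) (J : Finset HexVertex) (e : Sym2 HexVertex) : Prop :=
  (∀ v ∈ J, rad p v < s') ∧ (∀ v ∈ e, rad p v < s')

/-! ### (¬B) The card's single-crossing class is negligible -/

/-- **Single-crossing walks are negligible** (negative prediction refuting step (B) of the idea card):
for every `ε > 0`, once the lattice radius `s` is large, for every outer condition at radius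
`R ≥ 2s` and every target within `s/2` of `p`, the `x_c`-mass of the walks that cross the
half-circle `|z - p| = s` EXACTLY ONCE is at most `ε` times the total arrival mass.  Heuristic: a
critical SAW occupies `≍ s^{1/3}` edges of the unit collar of the circle; a single clean crossing
forces two half-plane arms from the crossing point, each costing `s^{-25/48}` (`n^{γ₁-γ}`,
`γ = 43/32`, `γ₁ = 61/64` (Cardy 1984), `n ≍ s^{4/3}`), so the fraction is `≍ s^{-25/24}`; over `m` nested
crosscuts the single-crossing skeleton of the card carries `∏ s_i^{-25/24} → 0`. -/
def SingleCrossingNegligible : Prop :=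
  ∀ ε : ℝ, 0 < ε → ∃ S₀ : ℝ, ∀ (p : ℂ) (n : ℤ) (s R : ℝ), S₀ ≤ s → 2 * s ≤ R →
    ∀ (Λ : Finset HexVertex) (q : Sym2 HexVertex), IsOuterCondition p n R Λ q →
    ∀ e ∈ hexDomainBoundary Λ, (∀ v ∈ e, rad p v < s / 2) →
      (∑ γ : HexMidEdgeSAW Λ q e,
          if numCrossings p s γ.verts = 1 then hexCriticalFugacity ^ γ.length else 0) ≤ ε * Z Λ q e

/-! ### (B′) Thick-annulus backtrack suppression -/

/-- **Backtrack suppression with a rate** (the correct form of the card's (B)): there are `C, α > 0`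
such that for every aspect `M ≥ 2`, every outer condition at radius `s ≥ M s'` (`s' ≥ 1`) and every
boundary target inside `B(p, s')`, the `x_c`-mass of the walks that cross the half-annulus
`s' ≤ |z - p| ≤ s` three times is at most `C M^{-α}` of the total.  (A three-crossing / retreat
event for the path pinned at both ends; Coulomb-gas prediction `α = x₃ - x₁`-type `> 0`; in strips
the tree's bridge decay `HexSAWBridgeDecay` is the one-directional analogue.  The engine needs only
`b(M) = o(1 / log M)`.) -/
def ThickBacktrackSuppression : Prop :=
  ∃ C α : ℝ, 0 < α ∧ ∀ (M : ℝ), 2 ≤ M → ∀ (p : ℂ) (n : ℤ) (s' s : ℝ), 1 ≤ s' → M * s' ≤ s →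
    ∀ (Λ : Finset HexVertex) (q : Sym2 HexVertex), IsOuterCondition p n s Λ q →
    ∀ e ∈ hexDomainBoundary Λ, (∀ v ∈ e, rad p v < s') →
      Z Λ q e - nbMass Λ q e p s' s ≤ C * M ^ (-α) * Z Λ q e

/-! ### (D′) One-block comparability with constants, walk level -/

/-- **Carved-block comparability** (the correct form of the card's one-scale Doeblin input (D),
including corner entrance points and arbitrary boundary conditions): there are `Δ₀` and an aspect
`M` such that for all radii `s ≥ M s'`, any two OUTER conditions at radius `s` and any two INNER
conditions at radius `s'`, the no-backtrack masses `Z(a,b) := nbMass (Λ_a ∖ J_b) q_a e_b` satisfy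
`Z(1,1) Z(2,2) ≤ e^{Δ₀} Z(1,2) Z(2,1)`.  Equivalently: the free-block transfer kernel between
thick-crosscut strand states (any strand system above radius `s`, any below radius `s'`) has Hilbert
projective diameter `≤ Δ₀` — constants only, no exponent, uniform in the lattice scale; decided scale
by scale by strip/annulus transfer matrices (`SAWStripTM*`).  (Zeros are consistent: if `Z(1,1)` and
`Z(2,2)` are positive, so are `Z(1,2)` and `Z(2,1)`, through the clean half-annulus.) -/
def CarvedBlockComparability : Prop :=
  ∃ Δ₀ M : ℝ, 2 ≤ M ∧ ∀ (p : ℂ) (n : ℤ) (s' s : ℝ), 1 ≤ s' → M * s' ≤ s →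
    ∀ (Λ₁ Λ₂ : Finset HexVertex) (q₁ q₂ : Sym2 HexVertex),
      IsOuterCondition p n s Λ₁ q₁ → IsOuterCondition p n s Λ₂ q₂ →
    ∀ (J₁ J₂ : Finset HexVertex) (e₁ e₂ : Sym2 HexVertex),
      IsInnerCondition p s' J₁ e₁ → IsInnerCondition p s' J₂ e₂ →
      nbMass (Λ₁ \ J₁) q₁ e₁ p s' s * nbMass (Λ₂ \ J₂) q₂ e₂ p s' s ≤
        Real.exp Δ₀ * (nbMass (Λ₁ \ J₂) q₁ e₂ p s' s * nbMass (Λ₂ \ J₁) q₂ e₁ p s' s)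

/-! ### Birkhoff–Hopf -/

/-- Hilbert's projective distance between two positive vectors on a finite index type:
`d_H(u,v) = log ( max_i (u_i/v_i) · max_i (v_i/u_i) )`. -/
def hilbertDist {ι : Type*} [Fintype ι] (u v : ι → ℝ) : ℝ :=
  Real.log ((⨆ i, u i / v i) * (⨆ i, v i / u i))

/-- **Birkhoff–Hopf contraction** (G. Birkhoff 1957; Seneta, Non-negative matrices §3; not in
Mathlib): a positive `m × n` kernel whose `2 × 2` cross-ratios are bounded by `e^{Δ}` (projective
diameter `≤ Δ`) maps any two positive vectors to vectors at Hilbert distance `≤ Δ`, and contracts the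
Hilbert distance by the factor `tanh(Δ/4) < 1`. -/
def BirkhoffHopfContraction : Prop :=
  ∀ (m n : ℕ) (K : Matrix (Fin m) (Fin n) ℝ) (Δ : ℝ), 0 < m → 0 < n → (∀ i j, 0 < K i j) →
    (∀ i i' j j', K i j * K i' j' ≤ Real.exp Δ * (K i j' * K i' j)) →
    ∀ u v : Fin n → ℝ, (∀ j, 0 < u j) → (∀ j, 0 < v j) →
      hilbertDist (K.mulVec u) (K.mulVec v) ≤ Δ ∧
        hilbertDist (K.mulVec u) (K.mulVec v) ≤ Real.tanh (Δ / 4) * hilbertDist u v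

/-! ### The engine's output and its shape -/

/-- **Flat-ball two-root boundary Harnack principle, qualitative form** (what the boundary-target
form of `RatioContinuity` at FLAT points and the `PointToDensity`/`K`-universality step at `b` consume;
NOT enough for `FlatLocality` / `FlatTrace (ii)`, which involve the bulk spin-`5/8` limit, where signal
is `δ^{25/48}` of the mass): for every `ε > 0` there is an aspect `M` such that for every simply connected `Λ` equal to
the flat half-lattice inside `B(p, R)`, two boundary roots at radius `≥ R` and two boundary targets
inside `B(p, r)` with `M r ≤ R`, the cross-ratio defect of the four arrival masses is `≤ ε`. -/
def FlatBoundaryRatioMixingQ : Prop :=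
  ∀ ε : ℝ, 0 < ε → ∃ M : ℝ, 1 ≤ M ∧ ∀ (p : ℂ) (n : ℤ) (r R : ℝ), 1 ≤ r → M * r ≤ R →
    ∀ (Λ : Finset HexVertex) (a a' : Sym2 HexVertex),
      IsOuterCondition p n R Λ a → IsOuterCondition p n R Λ a' →
    ∀ e ∈ hexDomainBoundary Λ, ∀ e' ∈ hexDomainBoundary Λ,
      (∀ v ∈ e, rad p v < r) → (∀ v ∈ e', rad p v < r) →
      |Z Λ a e * Z Λ a' e' - Z Λ a e' * Z Λ a' e| ≤ ε * (Z Λ a e * Z Λ a' e' + Z Λ a e' * Z Λ a' e)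

/-- **Shape of the repaired engine** (recorded for whichever line files `FlatBoundaryRatioMixingQ`
or one of its consumers as a stub; NOT registered here): Birkhoff–Hopf + carved-block comparability
+ thick backtrack suppression ⇒ flat-ball ratio mixing.  Internal lemma (exact combinatorics): with
thick crosscuts `Ā_i = {s_i ≤ |z-p| ≤ M s_i}` separated by free blocks, a walk with no backtrack
across any `Ā_i` has exactly ONE through-strand in each `Ā_i` (plus outer-rim loops before it and
inner-rim loops after it), so the strand system `ω ∩ Ā_i` is a separating state and the no-backtrack
mass is an exact product `v_q^⊤ 𝒲_0 ⋯ 𝒲_m w_e` of entrywise-positive free-block kernels; (D′) bounds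
their projective diameters, Birkhoff contracts by `tanh(Δ₀/4)` per block, (B′) removes the backtrack
class once; rate `(r/R)^{c / log M}` with `M ≍ log log (R/r)`, polynomial if `b(M)` decays like a
power. -/
def ContractionEngine : Prop :=
  BirkhoffHopfContraction → CarvedBlockComparability → ThickBacktrackSuppression →
    FlatBoundaryRatioMixingQ

end Summit.CriticalPhenomena.SAWScalingLimit.Cruxes.BoundaryClosureR.CruxplanBirkhoff

end
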